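import Literature.AlgebraicGeometry.Resolution.RsopMonomialIdeals
import Literature.RingTheory.RegularLocalRing.QuotientDVR
import HarnessLib

/-!
# Coherent junction sections are discrete valuation rings with uniformizer `ϖ` (crux `EquisingularLiftNat`,
# stmt-ResolutionOfSingularities-20038; child EL♮(3) stmt-ResolutionOfSingularities-20148; device rule R-ii, local half)

[OURS · L1 W4.5(b)] Companion of `…EquisingularLiftNatCoherentJunctionSections.lean` (p516897: blowing up the
scheme-theoretic junction separates the branches). NOT a statement of the manuscript under review (Hironaka 2017);
AI-written kernel lemma of the cell `res-hironaka`, weaker than expert review.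

**The local half of R-ii.** At a TRANSVERSAL junction `q` of two branches `C₃ = V(f₃)`, `C₄ = V(f₄)` of the
carrier `P` (regular of dimension `3` at `q`, over the DVR `(O, ϖ)`), transversality of the special fibres reads
`𝔪_{P,q} = (ϖ, f₃, f₄)`. Then `(f₃, f₄)` is part of a regular system of parameters, and the local ring of the
coherent junction section `s := C₃ ∩ C₄ = V(f₃, f₄)` at `q` is `𝒪_{P,q}/(f₃, f₄)`: a discrete valuation ring whose
maximal ideal is generated by the image of `ϖ` — i.e. `s` is regular of dimension one at `q`, its special fibre
is the reduced point `q`, and `ϖ` is a non-zero-divisor on it (torsion-free, hence flat, over `O`). Stated for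
any number `n` of branch equations `f : Fin n → R` with `𝔪 = (f, ϖ)` and `dim R = n + 1`.

* `isRsopPart_of_span_range_union_singleton` — `𝔪 = (f₁,…,f_n, ϖ)`, `dim R = n + 1` ⇒ `IsRsopPart f`;
* `isDiscreteValuationRing_quotient_of_isRsopPart` — `IsRsopPart f`, `dim R = n + 1` ⇒ `R/(f)` is a DVR;
* `maximalIdeal_quotient_eq_span_of_span_range_union_singleton` — the uniformizer of `R/(f)` is `ϖ̄`;
* `coherentJunctionSection_local` — the package at a junction (`n` arbitrary): `R/(f)` is a DVR, `𝔪̄ = (ϖ̄)`,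
  `ϖ̄ ≠ 0` is a non-zero-divisor.

References: H. Matsumura, *Commutative Ring Theory* (1986), Thm. 14.2, Thm. 11.2 [Matsumura1987] (tree:
`IsRsopPart.isRegularLocalRing_quotient`, `IsRsopPart.ringKrullDim_quotient_add`,
`isDiscreteValuationRing_of_ringKrullDim_eq_one`).
-/

-- single-problem summit: the doubled namespace component `ResolutionOfSingularities` is forced
set_option linter.dupNamespace false

noncomputable section

open IsLocalRing
open Literature.AlgebraicGeometry.Resolution
open Literature.RingTheory.RegularLocalRing

namespace Summit.ResolutionOfSingularities.ResolutionOfSingularities.Theorems.EquisingularLift.Junction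

universe u

variable {R : Type u} [CommRing R]

/-- **Transversal junction ⇒ part of a regular system of parameters.** In a Noetherian local ring of dimension
`n + 1` whose maximal ideal is generated by `f₁, …, f_n` and one more element `ϖ`, the family `f` is part of a
regular system of parameters (and `R` is regular). [cite: Matsumura1987, Thm. 14.2] -/
theorem isRsopPart_of_span_range_union_singleton [IsLocalRing R] [IsNoetherianRing R] {n : ℕ}
    (f : Fin n → R) (ϖ : R) (hdim : ringKrullDim R = (n + 1 : ℕ))
    (h𝔪 : Ideal.span (Set.range f ∪ {ϖ}) = maximalIdeal R) : IsRsopPart f := by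
  have hfin : (Set.range f ∪ {ϖ}).Finite := (Set.finite_range f).union (Set.finite_singleton ϖ)
  have hcard : (Set.range f ∪ {ϖ}).ncard ≤ n + 1 := by
    refine (Set.ncard_union_le _ _).trans ?_
    rw [Set.ncard_singleton]
    refine Nat.add_le_add_right ?_ 1
    calc (Set.range f).ncard ≤ (Set.univ : Set (Fin n)).ncard := by
          rw [← Set.image_univ]; exact Set.ncard_image_le (Set.finite_univ)
      _ = n := by rw [Set.ncard_univ, Nat.card_eq_fintype_card, Fintype.card_fin]
  have hR : IsRegularLocalRing R := by
    apply IsRegularLocalRing.of_spanFinrank_maximalIdeal_le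
    rw [hdim, ← h𝔪]
    have := Submodule.spanFinrank_span_le_ncard_of_finite (R := R) (M := R) hfin
    exact_mod_cast this.trans hcard
  refine ⟨hR, 1, ![ϖ], hdim, ?_⟩
  convert h𝔪 using 2
  ext a
  simp

/-- **Codimension-one part of a regular system of parameters ⇒ the quotient is a DVR** (Matsumura 14.2 + 11.2).
[cite: Matsumura1987, Thm. 14.2] -/
theorem isDiscreteValuationRing_quotient_of_isRsopPart [IsLocalRing R] {n : ℕ} {f : Fin n → R}
    (hf : IsRsopPart f) (hdim : ringKrullDim R = (n + 1 : ℕ)) :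
    haveI := hf.isRegularLocalRing_quotient
    haveI := isDomain_of_isRegularLocalRing (R ⧸ Ideal.span (Set.range f))
    IsDiscreteValuationRing (R ⧸ Ideal.span (Set.range f)) := by
  haveI := hf.isRegularLocalRing_quotient
  apply isDiscreteValuationRing_of_ringKrullDim_eq_one
  have h := hf.ringKrullDim_quotient_add
  rw [hdim] at h
  obtain ⟨m, hm⟩ := exists_nat_cast_eq_ringKrullDim (R := R ⧸ Ideal.span (Set.range f))
  rw [hm] at h ⊢
  have h' : (m + n : ℕ) = ((n + 1 : ℕ) : WithBot ℕ∞) := by exact_mod_cast h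
  have h'' : m + n = n + 1 := by exact_mod_cast h'
  have hm1 : m = 1 := by omega
  rw [hm1]
  rfl

/-- **The uniformizer is `ϖ̄`.** If `𝔪 = (f₁, …, f_n, ϖ)` then the maximal ideal of the local ring
`R/(f₁, …, f_n)` is generated by the image of `ϖ`. [folklore] -/
theorem maximalIdeal_quotient_eq_span_of_span_range_union_singleton [IsLocalRing R] {n : ℕ}
    (f : Fin n → R) (ϖ : R) (h𝔪 : Ideal.span (Set.range f ∪ {ϖ}) = maximalIdeal R) :
    haveI := isLocalRing_quotient (I := Ideal.span (Set.range f))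
      (fun h => by
        have : Ideal.span (Set.range f) ≤ maximalIdeal R := by
          rw [← h𝔪]; exact Ideal.span_mono Set.subset_union_left
        exact (maximalIdeal.isMaximal R).ne_top (top_le_iff.mp (h ▸ this)))
    maximalIdeal (R ⧸ Ideal.span (Set.range f)) =
      Ideal.span {Ideal.Quotient.mk (Ideal.span (Set.range f)) ϖ} := by
  set I : Ideal R := Ideal.span (Set.range f) with hI
  have hle : I ≤ maximalIdeal R := by
    rw [← h𝔪]; exact Ideal.span_mono Set.subset_union_left
  have hne : I ≠ ⊤ := fun h => (maximalIdeal.isMaximal R).ne_top (top_le_iff.mp (h ▸ hle))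
  haveI : Nontrivial (R ⧸ I) := Ideal.Quotient.nontrivial_iff.mpr hne
  haveI := isLocalRing_quotient hne
  rw [maximalIdeal_quotient_eq_map I, ← h𝔪, Ideal.map_span, Set.image_union, Set.image_singleton,
    Ideal.span_union]
  have h0 : Ideal.span (Ideal.Quotient.mk I '' Set.range f) = ⊥ := by
    rw [Ideal.span_eq_bot]
    rintro _ ⟨a, ha, rfl⟩
    exact Ideal.Quotient.eq_zero_iff_mem.mpr (Ideal.subset_span ha)
  rw [h0, bot_sup_eq]

/-- **The coherent junction section, locally** (rule R-ii of the sections-first device; the local half). Let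
`(R, 𝔪)` be a Noetherian local ring of dimension `n + 1` with `𝔪 = (f₁, …, f_n, ϖ)` — at a transversal junction
of the branches `V(fᵢ)` of the carrier over the DVR with uniformizer `ϖ` (`n = 2`: `𝔪_{P,q} = (f₃, f₄, ϖ)`). Then
the local ring `R/(f₁, …, f_n)` of the junction section `V(f₁, …, f_n)` is a discrete valuation ring (regular of
dimension one), its maximal ideal is `(ϖ̄)` (the special fibre of the section is the reduced closed point), and
`ϖ̄ ≠ 0` is a non-zero-divisor (the section is torsion-free, hence flat, over the DVR). OURS; crux
`EquisingularLiftNat` (stmt-ResolutionOfSingularities-20038, child stmt-ResolutionOfSingularities-20148); not a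
statement of the manuscript under review. [cite: Matsumura1987, Thm. 14.2] -/
theorem coherentJunctionSection_local [IsLocalRing R] [IsNoetherianRing R] {n : ℕ} (f : Fin n → R) (ϖ : R)
    (hdim : ringKrullDim R = (n + 1 : ℕ)) (h𝔪 : Ideal.span (Set.range f ∪ {ϖ}) = maximalIdeal R) :
    IsRsopPart f ∧
    ∃ (_ : IsDomain (R ⧸ Ideal.span (Set.range f))) (_ : IsLocalRing (R ⧸ Ideal.span (Set.range f))),
      IsDiscreteValuationRing (R ⧸ Ideal.span (Set.range f)) ∧
      maximalIdeal (R ⧸ Ideal.span (Set.range f)) = Ideal.span {Ideal.Quotient.mk (Ideal.span (Set.range f)) ϖ} ∧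
      Ideal.Quotient.mk (Ideal.span (Set.range f)) ϖ ≠ 0 ∧
      Ideal.Quotient.mk (Ideal.span (Set.range f)) ϖ ∈ nonZeroDivisors (R ⧸ Ideal.span (Set.range f)) := by
  have hf := isRsopPart_of_span_range_union_singleton f ϖ hdim h𝔪
  haveI hreg := hf.isRegularLocalRing_quotient
  haveI hdom := isDomain_of_isRegularLocalRing (R ⧸ Ideal.span (Set.range f))
  have hdvr := isDiscreteValuationRing_quotient_of_isRsopPart hf hdim
  have hmax := maximalIdeal_quotient_eq_span_of_span_range_union_singleton f ϖ h𝔪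
  have hne : Ideal.Quotient.mk (Ideal.span (Set.range f)) ϖ ≠ 0 := by
    intro h0
    apply IsDiscreteValuationRing.not_a_field (R ⧸ Ideal.span (Set.range f))
    rw [hmax, h0, Ideal.span_singleton_eq_bot]
  exact ⟨hf, hdom, inferInstance, hdvr, hmax, hne, mem_nonZeroDivisors_of_ne_zero hne⟩

end Summit.ResolutionOfSingularities.ResolutionOfSingularities.Theorems.EquisingularLift.Junction

end
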